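import Mathlib
import Summits.HodgeConjecture.FermatCycles.HodgeFermatHurwitzZeroA

/-!
# The Hurwitz zeta value `ζ(0, x) = 1/2 − x` — part 2: Abel's theorem, `sinZeta x 1`, the value (`HodgeFermat/HurwitzZero.lean` §§3–5)

Tree copy (part 2 of 2 of §§1–5) of the module `HodgeFermat/HurwitzZero.lean` of the sibling cell's standalone package
`run/shared/lean/pub/pub-hodgefermat/lean/HodgeFermat/` (528 lines, sha256 `93a0e2eafcc9afc5…`), source lines 236–497 (§3 the series `Σ wⁿ/n`, §4 `sinZeta x 1 = π/2 − πx`, §5 `ζ(0, x) = 1/2 − x`).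
Filed by cell `pub-hfermat`, seat prover-1 gen-0, on the COORDINATOR KEEPER RULING of 2026-08-25 (gem sweep H1: take the
off-gate kernel theorem `thmFstar` — `HodgeFermat/DecodingFinal.lean:29` — through the gate); this file is one link of the
minimal import closure of `thmFstar`.  The source module's declarations are VERBATIM those of the cell record
`check/DecodingFinal_standalone.lean` (27 bodies, 454 223 B, sha256 dca6f17de93119a6…, hub `lean check` rc 0, 130.1 s; pub-hodgefermat `CERT.md` l.978, GATE HF-G32).
Deviations from the source module, exhaustively: the `import` lines (tree modules `Summits.HodgeConjecture.FermatCycles.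
HodgeFermat*` instead of `HodgeFermat.*`); this module docstring; the `open`/namespace preamble (source l.44–46) is repeated at the top because the module is split; §6 of the source (the D6-chain corollaries) is not filed (see part 1); one-line docstrings added (gate lint) to `E_sub_E`, `norm_E_sub_E_le`, `cauchySeq_E`, `E_im`, `term_eq`, `S_sub_S`, `norm_S_sub_S_le`, `S_one`, `tendsto_S_one`, `continuous_S`, `coe_ne_zero`, `hurwitzZetaOdd_zero`, `hurwitzZeta_zero`. The module docstring is quoted in full in part 1.
Every other line — in particular every declaration's statement and proof — is byte-identical to the source.
HONEST FRAMING: explicit algebraic cycles for specific Hodge classes on Fermat/Delsarte varieties; residual open instances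
listed; no claim on general Hodge.  (This file is arithmetic of CM types; it claims nothing about cycles.)
-/

open Complex Filter Topology Finset HurwitzZeta

namespace HodgeFermat.KRFree.HurwitzZero

/-! ## 3. The series `∑ w^n / n` : convergence (Dirichlet test) and value (Abel's theorem) -/

section value

variable {x : ℝ}

/-- Partial sums `E M = ∑_{n<M} w^n / n` (the `n = 0` term is `1/0 = 0`). -/
noncomputable def E (x : ℝ) (M : ℕ) : ℂ := ∑ n ∈ range M, ew x ^ n / (n : ℂ)

/-- `E M′ − E M` as a weighted sum over `[M, M′)` -/
lemma E_sub_E (x : ℝ) {M M' : ℕ} (h : M ≤ M') :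
    E x M' - E x M = ∑ n ∈ Ico M M', ((n : ℝ)⁻¹) • (ew x ^ n) := by
  rw [E, E, ← Finset.sum_Ico_eq_sub _ h]
  refine Finset.sum_congr rfl (fun n _ => ?_)
  rw [Complex.real_smul, Complex.ofReal_inv, Complex.ofReal_natCast, div_eq_inv_mul]

/-- Abel bound on `‖E M′ − E M‖` -/
lemma norm_E_sub_E_le (hx0 : 0 < x) (hx1 : x < 1) {M M' : ℕ} (hM : 1 ≤ M) (h : M ≤ M') :
    ‖E x M' - E x M‖ ≤ 2 * bnd x * (M : ℝ)⁻¹ := by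
  rw [E_sub_E x h]
  refine abel_bound (fun n => ew x ^ n) (fun n => (n : ℝ)⁻¹) (bnd x) (geom_bound hx0 hx1)
    (fun i _ => by positivity) (fun i hi => ?_) h
  have hi0 : (0 : ℝ) < i := by exact_mod_cast (show 0 < i by omega)
  push_cast
  exact inv_anti₀ hi0 (by linarith)

/-- the partial sums `E x` form a Cauchy sequence -/
lemma cauchySeq_E (hx0 : 0 < x) (hx1 : x < 1) : CauchySeq (E x) := by
  refine Metric.cauchySeq_iff'.mpr (fun ε hε => ?_)
  obtain ⟨N, hN⟩ := exists_nat_gt (2 * bnd x / ε)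
  refine ⟨N + 1, fun n hn => ?_⟩
  rw [dist_eq_norm]
  have hN1 : (0 : ℝ) < (N + 1 : ℕ) := by positivity
  calc ‖E x n - E x (N + 1)‖ ≤ 2 * bnd x * ((N + 1 : ℕ) : ℝ)⁻¹ :=
        norm_E_sub_E_le hx0 hx1 (by omega) hn
    _ < ε := by
        rw [← div_eq_mul_inv, div_lt_iff₀ hN1]
        have hb := bnd_nonneg (x := x)
        have h1 : 2 * bnd x < (N : ℝ) * ε := by rwa [div_lt_iff₀ hε] at hN
        push_cast
        nlinarith

/-- The sum `ℓ = ∑_{n ≥ 1} w^n / n` equals `-log (1 - w)` (Abel's limit theorem + Taylor series of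
`-log (1 - z)` + continuity of `log` on the slit plane). -/
lemma tendsto_E (hx0 : 0 < x) (hx1 : x < 1) :
    Tendsto (E x) atTop (𝓝 (-Complex.log (1 - ew x))) := by
  obtain ⟨ℓ, hℓ⟩ := cauchySeq_tendsto_of_complete (cauchySeq_E hx0 hx1)
  -- Abel's theorem
  have hA : Tendsto (fun r : ℝ => ∑' n : ℕ, (ew x ^ n / (n : ℂ)) * (r : ℂ) ^ n) (𝓝[<] (1 : ℝ)) (𝓝 ℓ) := by
    have := Complex.tendsto_tsum_powerSeries_nhdsWithin_lt (f := fun n : ℕ => ew x ^ n / (n : ℂ)) hℓ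
    rw [Filter.tendsto_map'_iff] at this
    exact this
  -- identify with `-log (1 - w r)` for `0 < r < 1`
  have hEq : (fun r : ℝ => ∑' n : ℕ, (ew x ^ n / (n : ℂ)) * (r : ℂ) ^ n) =ᶠ[𝓝[<] (1 : ℝ)]
      (fun r : ℝ => -Complex.log (1 - ew x * r)) := by
    filter_upwards [Ioo_mem_nhdsLT (show (0 : ℝ) < 1 by norm_num)] with r hr
    have hnorm : ‖ew x * (r : ℂ)‖ < 1 := by
      rw [norm_mul, norm_ew, one_mul, Complex.norm_real, Real.norm_of_nonneg hr.1.le]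
      exact hr.2
    have hs := Complex.hasSum_taylorSeries_neg_log hnorm
    rw [← hs.tsum_eq]
    refine tsum_congr (fun n => ?_)
    rw [mul_pow]
    ring
  -- continuity of the right-hand side at `r = 1`
  have hC : Tendsto (fun r : ℝ => -Complex.log (1 - ew x * r)) (𝓝[<] (1 : ℝ))
      (𝓝 (-Complex.log (1 - ew x))) := by
    apply tendsto_nhdsWithin_of_tendsto_nhds
    have h1 : ContinuousAt (fun r : ℝ => 1 - ew x * (r : ℂ)) 1 := by fun_prop
    have h2 : ContinuousAt Complex.log (1 - ew x) :=
      continuousAt_clog (one_sub_ew_mem_slitPlane hx0 hx1)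
    have h3 : ContinuousAt (fun r : ℝ => -Complex.log (1 - ew x * (r : ℂ))) 1 :=
      (h2.comp_of_eq h1 (by simp)).neg
    have h4 := h3.tendsto
    simp only [Complex.ofReal_one, mul_one] at h4
    exact h4
  have : ℓ = -Complex.log (1 - ew x) := tendsto_nhds_unique (hA.congr' hEq) hC
  rwa [this] at hℓ

/-- `Im (E x M) = Σ_{n<M} sin (2πxn)/n` -/
lemma E_im (x : ℝ) (M : ℕ) : (E x M).im = ∑ n ∈ range M, Real.sin (2 * Real.pi * x * n) / n := by
  rw [E, Complex.im_sum]
  refine Finset.sum_congr rfl (fun n _ => ?_)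
  rw [Complex.div_natCast_im, ew_pow_im]

/-- `∑_{n ≥ 1} sin (2π n x) / n = π/2 - π x` (as a limit of partial sums, in `ℂ`). -/
lemma tendsto_sin_series (hx0 : 0 < x) (hx1 : x < 1) :
    Tendsto (fun M : ℕ => (((∑ n ∈ range M, Real.sin (2 * Real.pi * x * n) / n : ℝ)) : ℂ)) atTop
      (𝓝 (((Real.pi / 2 - Real.pi * x : ℝ)) : ℂ)) := by
  have h := tendsto_E hx0 hx1
  have h2 : Tendsto (fun M => (((E x M).im : ℝ) : ℂ)) atTop
      (𝓝 ((((-Complex.log (1 - ew x)).im : ℝ)) : ℂ)) :=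
    (Complex.continuous_ofReal.tendsto _).comp ((Complex.continuous_im.tendsto _).comp h)
  rw [neg_log_one_sub_ew_im hx0 hx1] at h2
  simpa only [Function.comp_def, E_im] using h2

end value

/-! ## 4. `sinZeta x 1 = π/2 - πx` (uniform tail bound on `s ≥ 1` and an `ε/4` argument) -/

section sinzeta

variable {x : ℝ}

/-- Partial sums of the Dirichlet series of `sinZeta x` at a real point `s`. -/
noncomputable def S (x s : ℝ) (M : ℕ) : ℂ :=
  ∑ n ∈ range M, ((Real.sin (2 * Real.pi * x * n) : ℝ) : ℂ) / (n : ℂ) ^ (s : ℂ)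

/-- a term of the Dirichlet series as a real scalar multiple -/
lemma term_eq (s : ℝ) (n : ℕ) (t : ℝ) :
    ((t : ℝ) : ℂ) / (n : ℂ) ^ (s : ℂ) = ((n : ℝ) ^ (-s)) • ((t : ℝ) : ℂ) := by
  rw [Complex.real_smul, ← Complex.ofReal_natCast, ← Complex.ofReal_cpow (Nat.cast_nonneg n),
    Real.rpow_neg (Nat.cast_nonneg n), Complex.ofReal_inv, div_eq_inv_mul]

/-- `S M′ − S M` as a weighted sum over `[M, M′)` -/
lemma S_sub_S (x s : ℝ) {M M' : ℕ} (h : M ≤ M') :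
    S x s M' - S x s M
      = ∑ n ∈ Ico M M', ((n : ℝ) ^ (-s)) • ((Real.sin (2 * Real.pi * x * n) : ℝ) : ℂ) := by
  rw [S, S, ← Finset.sum_Ico_eq_sub _ h]
  exact Finset.sum_congr rfl (fun n _ => term_eq s n _)

/-- uniform Abel bound on `‖S M′ − S M‖` for `s ≥ 1` -/
lemma norm_S_sub_S_le (hx0 : 0 < x) (hx1 : x < 1) {s : ℝ} (hs : 1 ≤ s) {M M' : ℕ} (hM : 1 ≤ M)
    (h : M ≤ M') : ‖S x s M' - S x s M‖ ≤ 2 * bnd x * (M : ℝ) ^ (-s) := by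
  rw [S_sub_S x s h]
  refine abel_bound (fun n => ((Real.sin (2 * Real.pi * x * n) : ℝ) : ℂ)) (fun n => (n : ℝ) ^ (-s))
    (bnd x) (sin_sum_bound hx0 hx1) (fun i _ => by positivity) (fun i hi => ?_) h
  have hi0 : (0 : ℝ) < i := by exact_mod_cast (show 0 < i by omega)
  have hle : (i : ℝ) ≤ ((i + 1 : ℕ) : ℝ) := by push_cast; linarith
  exact Real.rpow_le_rpow_of_nonpos hi0 hle (by linarith)

/-- Tail bound: `‖sinZeta x s - S_M(s)‖ ≤ 2B/M` for real `s > 1`, uniformly in `s`. -/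
lemma norm_sinZeta_sub_S_le (hx0 : 0 < x) (hx1 : x < 1) {s : ℝ} (hs : 1 < s) {M : ℕ}
    (hM : 1 ≤ M) : ‖sinZeta (x : UnitAddCircle) (s : ℂ) - S x s M‖ ≤ 2 * bnd x / M := by
  have hsum := hasSum_nat_sinZeta x (s := (s : ℂ)) (by simpa using hs)
  have htend : Tendsto (fun M' => S x s M') atTop (𝓝 (sinZeta (x : UnitAddCircle) (s : ℂ))) :=
    hsum.tendsto_sum_nat
  have h2 : Tendsto (fun M' => ‖S x s M' - S x s M‖) atTop
      (𝓝 ‖sinZeta (x : UnitAddCircle) (s : ℂ) - S x s M‖) := (htend.sub_const _).norm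
  refine le_of_tendsto h2 (Filter.eventually_atTop.mpr ⟨M, fun M' hM' => ?_⟩)
  have hM1 : (1 : ℝ) ≤ M := by exact_mod_cast hM
  have hb := bnd_nonneg (x := x)
  calc ‖S x s M' - S x s M‖ ≤ 2 * bnd x * (M : ℝ) ^ (-s) := norm_S_sub_S_le hx0 hx1 hs.le hM hM'
    _ ≤ 2 * bnd x * (M : ℝ) ^ (-1 : ℝ) :=
        mul_le_mul_of_nonneg_left (Real.rpow_le_rpow_of_exponent_le hM1 (by linarith))
          (by positivity)
    _ = 2 * bnd x / M := by rw [Real.rpow_neg_one, div_eq_mul_inv]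

/-- `S x 1 M` is the real partial sum `Σ_{n<M} sin (2πxn)/n` -/
lemma S_one (x : ℝ) (M : ℕ) :
    S x 1 M = (((∑ n ∈ range M, Real.sin (2 * Real.pi * x * n) / n : ℝ)) : ℂ) := by
  rw [S, Complex.ofReal_sum]
  refine Finset.sum_congr rfl (fun n _ => ?_)
  rw [Complex.ofReal_one, Complex.cpow_one, Complex.ofReal_div, Complex.ofReal_natCast]

/-- `S x 1 M → π/2 − πx` -/
lemma tendsto_S_one (hx0 : 0 < x) (hx1 : x < 1) :
    Tendsto (fun M => S x 1 M) atTop (𝓝 (((Real.pi / 2 - Real.pi * x : ℝ)) : ℂ)) := by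
  have : (fun M => S x 1 M) = fun M => (((∑ n ∈ range M, Real.sin (2 * Real.pi * x * n) / n : ℝ)) : ℂ) :=
    funext (S_one x)
  rw [this]
  exact tendsto_sin_series hx0 hx1

/-- `s ↦ S x s M` is continuous -/
lemma continuous_S (x : ℝ) (M : ℕ) : Continuous (fun s : ℝ => S x s M) := by
  unfold S
  refine continuous_finsetSum _ (fun n _ => ?_)
  rcases Nat.eq_zero_or_pos n with rfl | hn
  · simp only [Nat.cast_zero, mul_zero, Real.sin_zero, Complex.ofReal_zero, zero_div]
    exact continuous_const
  · have hn' : (n : ℂ) ≠ 0 := by exact_mod_cast hn.ne'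
    refine Continuous.div continuous_const ?_ (fun s => ?_)
    · refine continuous_iff_continuousAt.mpr (fun s => ?_)
      exact (continuousAt_const_cpow hn').comp Complex.continuous_ofReal.continuousAt
    · rw [Ne, Complex.cpow_eq_zero_iff, not_and_or]
      exact Or.inl hn'

/-- **The boundary value** `sinZeta x 1 = π (1/2 - x)` for `0 < x < 1`. -/
theorem sinZeta_one (hx0 : 0 < x) (hx1 : x < 1) :
    sinZeta (x : UnitAddCircle) 1 = (((Real.pi / 2 - Real.pi * x : ℝ)) : ℂ) := by
  set L := sinZeta (x : UnitAddCircle) 1 with hL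
  set T : ℂ := (((Real.pi / 2 - Real.pi * x : ℝ)) : ℂ) with hT
  by_contra hne
  have hpos : 0 < ‖L - T‖ := norm_pos_iff.mpr (sub_ne_zero.mpr hne)
  set ε := ‖L - T‖ / 5 with hεdef
  have hε : 0 < ε := by positivity
  -- choose the truncation level `M`
  obtain ⟨M, hM1, hMB, hMT⟩ : ∃ M : ℕ, 1 ≤ M ∧ 2 * bnd x / M < ε ∧ ‖S x 1 M - T‖ < ε := by
    have h1 : ∀ᶠ M : ℕ in atTop, 1 ≤ M := eventually_ge_atTop 1
    have h2 : ∀ᶠ M : ℕ in atTop, 2 * bnd x / (M : ℝ) < ε :=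
      (tendsto_const_div_atTop_nhds_zero_nat (2 * bnd x)).eventually (gt_mem_nhds hε)
    have h3 : ∀ᶠ M : ℕ in atTop, ‖S x 1 M - T‖ < ε := by
      have := (tendsto_iff_norm_sub_tendsto_zero.mp (tendsto_S_one hx0 hx1)).eventually
        (gt_mem_nhds hε)
      exact this
    obtain ⟨M, hM⟩ := (h1.and (h2.and h3)).exists
    exact ⟨M, hM.1, hM.2.1, hM.2.2⟩
  -- choose the real point `s > 1`
  obtain ⟨s, hs1, hsL, hsS⟩ : ∃ s : ℝ, 1 < s ∧ ‖L - sinZeta (x : UnitAddCircle) (s : ℂ)‖ < ε ∧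
      ‖S x s M - S x 1 M‖ < ε := by
    have e1 : ∀ᶠ s : ℝ in 𝓝[>] (1 : ℝ), 1 < s := eventually_nhdsWithin_of_forall (fun s hs => hs)
    have e2 : ∀ᶠ s : ℝ in 𝓝[>] (1 : ℝ), ‖L - sinZeta (x : UnitAddCircle) (s : ℂ)‖ < ε := by
      have hc : Tendsto (fun s : ℝ => sinZeta (x : UnitAddCircle) (s : ℂ)) (𝓝 1) (𝓝 L) := by
        have h := ((differentiableAt_sinZeta (x : UnitAddCircle)).continuous.tendsto (1 : ℂ)).comp
          (Complex.continuous_ofReal.tendsto 1)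
        rw [hL]
        simpa only [Function.comp_def, Complex.ofReal_one] using h
      have h' := Metric.tendsto_nhds.mp
        (tendsto_nhdsWithin_of_tendsto_nhds (s := Set.Ioi (1 : ℝ)) hc) ε hε
      refine h'.mono (fun s h => ?_)
      rwa [dist_comm, dist_eq_norm] at h
    have e3 : ∀ᶠ s : ℝ in 𝓝[>] (1 : ℝ), ‖S x s M - S x 1 M‖ < ε := by
      have hc := (continuous_S x M).tendsto 1
      have h' := Metric.tendsto_nhds.mp
        (tendsto_nhdsWithin_of_tendsto_nhds (s := Set.Ioi (1 : ℝ)) hc) ε hε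
      refine h'.mono (fun s h => ?_)
      rwa [dist_eq_norm] at h
    obtain ⟨s, hs⟩ := (e1.and (e2.and e3)).exists
    exact ⟨s, hs.1, hs.2.1, hs.2.2⟩
  have htail := norm_sinZeta_sub_S_le hx0 hx1 hs1 hM1
  have key : ‖L - T‖ < 4 * ε :=
    calc ‖L - T‖ ≤ ‖L - sinZeta (x : UnitAddCircle) (s : ℂ)‖
          + ‖sinZeta (x : UnitAddCircle) (s : ℂ) - T‖ := norm_sub_le_norm_sub_add_norm_sub _ _ _
      _ ≤ ‖L - sinZeta (x : UnitAddCircle) (s : ℂ)‖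
          + (‖sinZeta (x : UnitAddCircle) (s : ℂ) - S x s M‖ + ‖S x s M - T‖) := by
          gcongr; exact norm_sub_le_norm_sub_add_norm_sub _ _ _
      _ ≤ ‖L - sinZeta (x : UnitAddCircle) (s : ℂ)‖
          + (‖sinZeta (x : UnitAddCircle) (s : ℂ) - S x s M‖
            + (‖S x s M - S x 1 M‖ + ‖S x 1 M - T‖)) := by
          gcongr; exact norm_sub_le_norm_sub_add_norm_sub _ _ _
      _ < ε + (ε + (ε + ε)) := by gcongr; exact lt_of_le_of_lt htail hMB
      _ = 4 * ε := by ring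
  have : ‖L - T‖ = 5 * ε := by rw [hεdef]; ring
  linarith

end sinzeta

/-! ## 5. The value `ζ(0, x) = 1/2 - x` -/

section hurwitz

variable {x : ℝ}

/-- `x` is non-zero in `ℝ/ℤ` for `0 < x < 1` -/
lemma coe_ne_zero (hx0 : 0 < x) (hx1 : x < 1) : ((x : ℝ) : UnitAddCircle) ≠ 0 := by
  intro h
  obtain ⟨n, hn⟩ := (AddCircle.coe_eq_zero_iff (1 : ℝ)).mp h
  rw [zsmul_eq_mul, mul_one] at hn
  exact ne_int hx0 hx1 n hn

/-- `hurwitzZetaOdd x 0 = 1/2 − x` for `0 < x < 1` (functional equation at `s = 1` + `sinZeta_one`) -/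
theorem hurwitzZetaOdd_zero (hx0 : 0 < x) (hx1 : x < 1) :
    hurwitzZetaOdd ((x : ℝ) : UnitAddCircle) 0 = 1 / 2 - (x : ℂ) := by
  have hs : ∀ n : ℕ, (1 : ℂ) ≠ -(n : ℂ) := by
    intro n h
    have := congrArg Complex.re h
    simp at this
    linarith [n.cast_nonneg (α := ℝ)]
  have h := hurwitzZetaOdd_one_sub ((x : ℝ) : UnitAddCircle) (s := 1) hs
  rw [sub_self] at h
  rw [h, sinZeta_one hx0 hx1, Complex.Gamma_one, mul_one, mul_one, Complex.sin_pi_div_two,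
    Complex.cpow_neg_one]
  have hpi : (Real.pi : ℂ) ≠ 0 := Complex.ofReal_ne_zero.mpr Real.pi_ne_zero
  push_cast
  field_simp

/-- **`ζ(0, x) = 1/2 − x`** for `0 < x < 1` (Mathlib's `hurwitzZeta` on `ℝ/ℤ`) -/
theorem hurwitzZeta_zero (hx0 : 0 < x) (hx1 : x < 1) :
    hurwitzZeta ((x : ℝ) : UnitAddCircle) 0 = 1 / 2 - (x : ℂ) := by
  rw [hurwitzZeta, hurwitzZetaEven_apply_zero, if_neg (coe_ne_zero hx0 hx1), zero_add,
    hurwitzZetaOdd_zero hx0 hx1]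

end hurwitz

end HodgeFermat.KRFree.HurwitzZero
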